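import Literature.NumberTheory.EllipticCurves.CPMuDescentCurve
import Literature.NumberTheory.EllipticCurves.ThreeTorsionDescentHom
import HarnessLib

/-!
# Local necessity for Cohen–Pazuki's `μ₃`-descent: `[C_u]` restricts to zero at a `K`-field `E`
# only if `u` is, up to cubes, a power of a descent value `α̂(P)`, `P ∈ Ê(E)`
# (Cohen–Pazuki 2009, Prop. 1.4 (2) `Ker α̂ = Im φ`, read place by place; Silverman X.4.2 / X.4.9)

Topic `NumberTheory/EllipticCurves`. Sequel of `CPMuDescentCurve` (the curves
`E = cpCurve a b : y² = x³ − 3(ax + b)²`, the `μ₃`-kernel datum `T = (0, b√−3)`, the torsor classes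
`[C_u] = (kernelDatum hb hd).torsorClass hu ∈ H¹(K, E)`, the local Vélu pair) and
`CPMuDescentGFunction` (the functions `g_{±} = (y ± (ax + 3b))/x`), generalising the tree's
`MordellCurveThreeDescentLocalConverse` (the case `a = 0`) to `a ≠ 0`. Everything here is proved.

**The theorem** (`exists_descent_pow_eq_of_torsorClass_mem_localRestrictionKer`). Let `t ∈ K*` and
`m₂, s₂` with `t m₂ = 3a`, `t³ s₂ = 4a³ + 9b`, so that `Ê := threeTorsionModel m₂ s₂` is Cohen–Pazuki's
isogenous curve (`variableChange_codomain`), with descent map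
`α̂ = ThreeTorsionDescent.descent Ê m₂ s₂ : (X, Y) ↦ Y − (m₂X + s₂)` (tree, Definition 1.3 with
`√D̂ = 3/t`). Let `E ⊇ K` be any field (a completion). If `[C_u]`, `u ∈ K*`, lies in the local kernel
`WeierstrassCurve.localRestrictionKer (cpCurve a b) E` — restricts to zero in `H¹(E, E(Ē))` — then

  `α̂(P)^e = u · w³` for some `P ∈ Ê(E)`, `w ∈ E*`, `e ∈ ℕ`

(in fact `e ∈ {1, 2}`): the class of `u` in `E*/E*³` lies in the subgroup generated by the local descent
values. So every explicit confinement of the local images `α̂(Ê(K_v))` (valuations: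
`ThreeTorsionDescentValuation`) bounds `Ш(E/K) ∩ im [C_·]` from above — the Selmer side of the descent.
Corollaries `…_adicCompletion_of_torsorClass_mem_sha`, `…_infinitePlace_of_torsorClass_mem_sha`.

Proof (template: `MordellDescent.exists_phiDescent_eq_of_torsorClass_mem_localRestrictionKer`): a
restricted coboundary `n(τ) T_E = τ b₀ − b₀`, `b₀ ∈ E(Ē)`, `n(τ) = kummerExp u (τ|_K̄)`, gives — for
`b₀ ∈ {O, ±T_E}` — `n = (ε − 1) j` on `Γ_E` and `u ∈ E*³` (`P = O`); for `b₀ = (x, y)`, `x ≠ 0`, the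
point `φ(b₀)` is `Γ_E`-fixed hence `E`-rational, giving `P = ((X − 4a²)/t², ±Y/t³) ∈ Ê(E)`, and
`g_±(b₀) (ι∛u)^{e_±}` (`e₊ = 2`, `e₋ = 1`) is `Γ_E`-fixed (`τ` multiplies `ι∛u` by `ι(ω)^{n(τ)}` and
`g_±(b₀)` by `ι(ω)^{±n(τ)}`: `gFun_add_nsmul_T`) with cube `g_±³ · u^{e_±}`, where `g_±³` is `t³` times
the descent value of `∓P` (`gFun_pow_three`); whichever of `g_±(b₀)` is non-zero (`gFun_ne_zero_or`)
exhibits `u` or `u²` as a descent value times a cube.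

## References

* [CohenPazuki2009] H. Cohen, F. Pazuki, *Elementary 3-descent with a 3-isogeny*, Acta Arith. 140
  (2009), Definition 1.3, Proposition 1.4 (2), Theorem 2.1 / §4 (local images).
* [SilvermanAEC2009] J. H. Silverman, *The Arithmetic of Elliptic Curves*, 2nd ed., Thm. X.4.2 and
  Prop. X.4.9 (the local conditions cutting out the Selmer group of an isogeny).
* Template in the tree: `Literature.NumberTheory.EllipticCurves.MordellCurveThreeDescentLocalConverse`.
-/

noncomputable section

open scoped Classical

open WeierstrassCurve

universe u

namespace Literature.NumberTheory.EllipticCurves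

namespace CPMuDescent

open MordellDescent ThreeTorsionDescent

/-! ## Point-level supplements -/

section PointAlgebra

variable {F : Type u} [Field F] {W W' : WeierstrassCurve F} {m s : F}

/-- A point off the kernel `{O, ±T}` stays off the kernel after translation by a multiple of `T`:
it is affine with `x ≠ 0`. [cite: CohenPazuki2009, Proposition 1.4 (1)] -/
theorem exists_eq_some_of_add_nsmul_T (hV : IsVeluThreePair m s W W') {x y : F}
    (h : W.toAffine.Nonsingular x y) (hx : x ≠ 0) (k : ℕ) :
    ∃ (x' y' : F) (h' : W.toAffine.Nonsingular x' y'),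
      Affine.Point.some x y h + k • hV.T = Affine.Point.some x' y' h' ∧ x' ≠ 0 := by
  have hker : hV.pointFun (Affine.Point.some x y h + k • hV.T) ≠ 0 := by
    rw [← hV.pointHom_apply, map_add, map_nsmul, hV.pointHom_apply, hV.pointHom_apply, hV.pointFun_T,
      smul_zero, add_zero, hV.pointFun_some _ hx]
    exact Affine.Point.some_ne_zero _
  rcases hQ : Affine.Point.some x y h + k • hV.T with _ | ⟨x', y', h'⟩
  · rw [hQ, ← Affine.Point.zero_def, hV.pointFun_zero] at hker
    exact absurd rfl hker
  · refine ⟨x', y', h', rfl, fun hx' => hker ?_⟩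
    rw [hQ, hV.pointFun_some_of_eq_zero _ hx']

variable {a b θ : F}

/-- **The image of the `3`-isogeny lies on Cohen–Pazuki's `Ê`**: for `(x, y)` on `W`, `x ≠ 0`,
`Y² = (X − 4a²)³ + (3a(X − 4a²) + 4a³ + 9b)²` with `(X, Y) = (hV.X x, hV.Y x y)` — Vélu's quotient
translated by `4a²` is `Y² = X_Ê³ + (3aX_Ê + 4a³ + 9b)²`. [cite: CohenPazuki2009, Definition 1.3] -/
theorem Y_sq_eq (hV : IsVeluThreePair (a * θ) (b * θ) W W') (hθ : θ ^ 2 = -3)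
    {x y : F} (h : W.toAffine.Nonsingular x y) (hx : x ≠ 0) :
    hV.Y x y ^ 2 = (hV.X x - 4 * a ^ 2) ^ 3 + (3 * a * (hV.X x - 4 * a ^ 2) + (4 * a ^ 3 + 9 * b)) ^ 2 := by
  have e := hV.equation_image h.left hx
  rw [hV.equation'_iff] at e
  linear_combination e + (-27 * b ^ 2 + 48 * a ^ 3 * b - 16 * a ^ 3 * b * θ ^ 2
    - 18 * hV.X x * a * b + hV.X x ^ 2 * a ^ 2) * hθ

/-- The scaled form: with `t m₂ = 3a`, `t³ s₂ = 4a³ + 9b`, `t ≠ 0`, the point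
`((X − 4a²)/t², Y/t³)` satisfies the equation of `threeTorsionModel m₂ s₂`.
[cite: CohenPazuki2009, Definition 1.3] -/
theorem equation_scaled {X Y t m₂ s₂ : F} (ht : t ≠ 0) (hm₂ : t * m₂ = 3 * a)
    (hs₂ : t ^ 3 * s₂ = 4 * a ^ 3 + 9 * b)
    (hE : Y ^ 2 = (X - 4 * a ^ 2) ^ 3 + (3 * a * (X - 4 * a ^ 2) + (4 * a ^ 3 + 9 * b)) ^ 2) :
    (threeTorsionModel m₂ s₂).toAffine.Equation ((X - 4 * a ^ 2) / t ^ 2) (Y / t ^ 3) := by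
  rw [equation_iff_of_eq (rfl : threeTorsionModel m₂ s₂ = threeTorsionModel m₂ s₂)]
  have hm : m₂ = 3 * a / t := by field_simp; linear_combination hm₂
  have hs : s₂ = (4 * a ^ 3 + 9 * b) / t ^ 3 := by field_simp; linear_combination hs₂
  rw [hm, hs]
  field_simp
  linear_combination hE

/-- `threeTorsionModel m₂ s₂` is elliptic when `t m₂ = 3a`, `t³ s₂ = 4a³ + 9b` with `b ≠ 0`,
`4a³ + 9b ≠ 0`: `16 s₂³ (4m₂³ − 27 s₂) = 16 s₂³ · (−243 b/t³) ≠ 0`. [cite: CohenPazuki2009, §1.2] -/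
theorem Δ_scaled_ne [CharZero F] {t m₂ s₂ : F} (hb : b ≠ 0) (hd : 4 * a ^ 3 + 9 * b ≠ 0)
    (hm₂ : t * m₂ = 3 * a) (hs₂ : t ^ 3 * s₂ = 4 * a ^ 3 + 9 * b) :
    (threeTorsionModel m₂ s₂).Δ ≠ 0 := by
  rw [Δ_threeTorsionModel]
  have hs0 : s₂ ≠ 0 := by
    intro h0; rw [h0, mul_zero] at hs₂; exact hd hs₂.symm
  have hdisc : 4 * m₂ ^ 3 - 27 * s₂ ≠ 0 := by
    intro h0
    have e : t ^ 3 * (4 * m₂ ^ 3 - 27 * s₂) = 4 * (t * m₂) ^ 3 - 27 * (t ^ 3 * s₂) := by ring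
    rw [h0, mul_zero, hm₂, hs₂] at e
    have : (243 : F) * b = 0 := by linear_combination e
    exact hb (by simpa using this)
  exact mul_ne_zero (mul_ne_zero (by norm_num) (pow_ne_zero 3 hs0)) hdisc

end PointAlgebra

/-! ## Local necessity -/

section Local

variable {K : Type u} [Field K] [CharZero K]
variable {a b : K} (hb : b ≠ 0) (hd : 4 * a ^ 3 + 9 * b ≠ 0) {t m₂ s₂ : K}
variable {E : Type u} [Field E] [Algebra K E]

/-- **Local necessity for the `μ₃`-descent.** For a `K`-field `E`: if the torsor class `[C_u]` of
`u ∈ K*` restricts to zero in `H¹(E, E(Ē))` (`[C_u] ∈ localRestrictionKer (cpCurve a b) E`), then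
`α̂(P)^e = u · w³` for some `P ∈ Ê(E)`, `w ∈ E*`, `e ∈ ℕ`, where `Ê = threeTorsionModel m₂ s₂` over `E`
(`t m₂ = 3a`, `t³ s₂ = 4a³ + 9b`) and `α̂ = ThreeTorsionDescent.descent` is Cohen–Pazuki's descent map —
the local condition defining the `α̂`-Selmer group (Silverman X.4.2/X.4.9) is NECESSARY for `Ш`,
Cohen–Pazuki's `Ker α̂ = Im φ` read over `E`.
[cite: CohenPazuki2009, Proposition 1.4 (2)] [cite: SilvermanAEC2009, Thm. X.4.2(a) and Prop. X.4.9] -/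
theorem exists_descent_pow_eq_of_torsorClass_mem_localRestrictionKer (ht : t ≠ 0)
    (hm₂ : t * m₂ = 3 * a) (hs₂ : t ^ 3 * s₂ = 4 * a ^ 3 + 9 * b) {u : K} (hu : u ≠ 0)
    (hmem : (kernelDatum hb hd).torsorClass hu ∈ (cpCurve a b).localRestrictionKer E) :
    ∃ (P : (threeTorsionModel (algebraMap K E m₂) (algebraMap K E s₂)).toAffine.Point) (w : E) (e : ℕ),
      w ≠ 0 ∧ descent (threeTorsionModel (algebraMap K E m₂) (algebraMap K E s₂))
        (algebraMap K E m₂) (algebraMap K E s₂) P ^ e = algebraMap K E u * w ^ 3 := by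
  haveI : CharZero E := charZero_of_injective_algebraMap (algebraMap K E).injective
  have hV := isVeluThreePair_local (E := E) hb hd
  have hθ := thetaE_sq (K := K) (E := E)
  have hιinj : Function.Injective (iotaE (K := K) E) := (iotaE (K := K) E).toRingHom.injective
  have hEinj : Function.Injective (algebraMap E (AlgebraicClosure E)) :=
    (algebraMap E (AlgebraicClosure E)).injective
  -- the parameters in `E` and in `Ē`
  set aE := algebraMap K E a with haE
  set bE := algebraMap K E b with hbE
  set tE := algebraMap K E t with htE
  set mE := algebraMap K E m₂ with hmE
  set sE := algebraMap K E s₂ with hsE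
  set uE := algebraMap K E u with huE
  have hKinj := (algebraMap K E).injective
  have hbE0 : bE ≠ 0 := (map_ne_zero_iff _ hKinj).mpr hb
  have htE0 : tE ≠ 0 := (map_ne_zero_iff _ hKinj).mpr ht
  have huE0 : uE ≠ 0 := (map_ne_zero_iff _ hKinj).mpr hu
  have hdE : 4 * aE ^ 3 + 9 * bE ≠ 0 := by
    have := (map_ne_zero_iff _ hKinj).mpr hd
    rwa [map_add, map_mul, map_mul, map_pow, map_ofNat, map_ofNat] at this
  have hmE2 : tE * mE = 3 * aE := by
    rw [htE, hmE, haE, ← map_mul, hm₂, map_mul, map_ofNat]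
  have hsE2 : tE ^ 3 * sE = 4 * aE ^ 3 + 9 * bE := by
    rw [htE, hsE, haE, hbE, ← map_pow, ← map_mul, hs₂]
    simp only [map_add, map_mul, map_pow, map_ofNat]
  have hcEa : cE E a = algebraMap E (AlgebraicClosure E) aE := cE_eq a
  have hcEb : cE E b = algebraMap E (AlgebraicClosure E) bE := cE_eq b
  have huĒ : algebraMap K (AlgebraicClosure E) u = algebraMap E (AlgebraicClosure E) uE :=
    IsScalarTower.algebraMap_apply K E (AlgebraicClosure E) u
  -- cube roots of unity and of `u` in `Ē`
  have hω3 : iotaE (K := K) E (omega K) ^ 3 = 1 := iotaE_omega_pow_three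
  have hωθ : iotaE (K := K) E (omega K) = (thetaE K E - 1) / 2 := iotaE_omega
  have hω2 : ((-thetaE K E - 1) / 2) = iotaE (K := K) E (omega K) ^ 2 := by
    rw [hωθ]; field_simp; linear_combination -hθ
  have hα3 : iotaE (K := K) E (cubeRoot u) ^ 3 = algebraMap E (AlgebraicClosure E) uE := by
    rw [← map_pow, cubeRoot_pow_three, AlgHom.commutes, huĒ]
  have hτα : ∀ τ : Field.absoluteGaloisGroup E, galAutE E τ (iotaE (K := K) E (cubeRoot u)) =
      iotaE (K := K) E (omega K) ^ (kummerExp u (resGal (K := K) E τ)).val * iotaE (K := K) E (cubeRoot u) :=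
    fun τ => galAutE_iotaE_cubeRoot hu τ
  have hτE : ∀ (τ : Field.absoluteGaloisGroup E) (e : E),
      galAutE E τ (algebraMap E (AlgebraicClosure E) e) = algebraMap E (AlgebraicClosure E) e :=
    fun τ e => (galAutE E τ).commutes e
  -- notation for the exponent `n(τ) = kummerExp u (τ|_K̄)`
  set n : Field.absoluteGaloisGroup E → ZMod 3 := fun τ => kummerExp u (resGal (K := K) E τ) with hn
  -- the restricted class is a coboundary: `n(τ) T_E = τ b₀ − b₀`
  unfold MuThreeKernel.torsorClass WeierstrassCurve.localRestrictionKer at hmem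
  rw [oneCocycleClass_mem_resKer_iff] at hmem
  obtain ⟨b₀, hb₀⟩ := hmem
  have hpinj : Function.Injective (pointsMap (cpCurve a b) E) := pointsMapOfEmb_injective (cpCurve a b) _
  have hbχ : ∀ τ : Field.absoluteGaloisGroup E,
      pointsMap (cpCurve a b) E ((kernelDatum hb hd).chiT (n τ)) = τ • b₀ - b₀ := fun τ => hb₀ τ
  set TE : localPoints (cpCurve a b) E := hV.T with hTE
  have hχT : ∀ k : ZMod 3, pointsMap (cpCurve a b) E ((kernelDatum hb hd).chiT k) = k.val • TE :=
    fun k => pointsMap_chiT hb hd k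
  have hσb : ∀ τ : Field.absoluteGaloisGroup E, τ • b₀ = b₀ + (n τ).val • TE := fun τ => by
    rw [← hχT, hbχ τ, add_sub_cancel]
  -- the target curve over `E` and its descent map
  set W₂ : WeierstrassCurve E := threeTorsionModel mE sE with hW₂
  have hΔ₂ : W₂.Δ ≠ 0 := Δ_scaled_ne hbE0 hdE hmE2 hsE2
  /- the CUBE CASE: if `n(τ) = (ε(τ) − 1) j` on `Γ_E` then `ι(ω)^{−j} ι∛u ∈ E` and `u ∈ E*³`,
  so `P = O` works -/
  have cube_case : ∀ j : ZMod 3, (∀ τ : Field.absoluteGaloisGroup E, n τ = (eps (resGal (K := K) E τ) - 1) * j) →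
      ∃ (P : W₂.toAffine.Point) (w : E) (e : ℕ), w ≠ 0 ∧ descent W₂ mE sE P ^ e = uE * w ^ 3 := by
    intro j hj
    set α' : AlgebraicClosure E := iotaE (K := K) E (omega K ^ (-j).val) * iotaE (K := K) E (cubeRoot u)
      with hα'
    have hfix : ∀ τ : Field.absoluteGaloisGroup E, galAutE E τ α' = α' := by
      intro τ
      rw [hα', map_mul, hτα τ, ← iotaE_galAut_resGal, galAut_omega_pow, ← mul_assoc, ← map_pow,
        ← map_mul, ← pow_add]
      congr 2
      rw [omega_pow_eq_pow_iff]
      push_cast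
      rw [epsNat_cast, ZMod.natCast_zmod_val, ZMod.natCast_zmod_val,
        show kummerExp u (resGal (K := K) E τ) = n τ from rfl, hj τ]
      ring
    obtain ⟨w₀, hw₀⟩ := exists_algebraMap_eq_of_forall_galAut (K := E) hfix
    have hw₀3 : algebraMap E (AlgebraicClosure E) (w₀ ^ 3) = algebraMap E (AlgebraicClosure E) uE := by
      rw [map_pow, hw₀, hα', mul_pow, ← map_pow, ← pow_mul, mul_comm (-j).val 3, pow_mul, omega_pow_three,
        one_pow, map_one, one_mul, hα3]
    have huw : uE = w₀ ^ 3 := (hEinj hw₀3).symm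
    have hw₀0 : w₀ ≠ 0 := by rintro rfl; exact huE0 (by rw [huw]; ring)
    refine ⟨0, w₀⁻¹, 1, inv_ne_zero hw₀0, ?_⟩
    rw [descent_zero, one_pow, huw, inv_pow, mul_inv_cancel₀ (pow_ne_zero 3 hw₀0)]
  rcases b₀ with _ | ⟨xb, yb, hxyb⟩
  · -- `b₀ = O`: the restricted cocycle vanishes, `n = 0`
    refine cube_case 0 fun τ => (kernelDatum hb hd).chiT_injective (hpinj ?_)
    rw [mul_zero, map_zero, map_zero, hbχ τ]
    change τ • (0 : localPoints (cpCurve a b) E) - 0 = 0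
    rw [smul_zero, sub_zero]
  · by_cases hxb : xb = 0
    · -- `b₀ = ±T_E = pointsMap (±T)`: `n(τ) T_E = (ε(τ) − 1)(±T_E)`
      rcases hV.some_eq_T_or hxyb hxb with hbT | hbT
      · refine cube_case 1 fun τ => (kernelDatum hb hd).chiT_injective (hpinj ?_)
        have h1 : (Affine.Point.some xb yb hxyb : localPoints (cpCurve a b) E) =
            pointsMap (cpCurve a b) E ((kernelDatum hb hd).chiT 1) := by
          rw [MuThreeKernel.chiT_one, kernelDatum_T, pointsMap_torsT]; exact hbT
        rw [hbχ τ, h1, smul_pointsMap_chiT_sub]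
      · refine cube_case (-1) fun τ => (kernelDatum hb hd).chiT_injective (hpinj ?_)
        have h1 : (Affine.Point.some xb yb hxyb : localPoints (cpCurve a b) E) =
            pointsMap (cpCurve a b) E ((kernelDatum hb hd).chiT (-1)) := by
          rw [map_neg, MuThreeKernel.chiT_one, kernelDatum_T, map_neg, pointsMap_torsT]; exact hbT
        rw [hbχ τ, h1, smul_pointsMap_chiT_sub]
    · /- MAIN CASE `b₀ = (x, y)`, `x ≠ 0`: `φ(b₀)` is `Γ_E`-invariant, hence `E`-rational -/
      set b₀ : localPoints (cpCurve a b) E := Affine.Point.some xb yb hxyb with hbdef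
      have hmove : ∀ τ : Field.absoluteGaloisGroup E, ∃ (x' y' : AlgebraicClosure E)
          (h' : ((cpCurve a b).baseChange (AlgebraicClosure E)).toAffine.Nonsingular x' y'),
          Affine.Point.some xb yb hxyb + (n τ).val • hV.T = Affine.Point.some x' y' h' ∧ x' ≠ 0 ∧
            galAutE E τ xb = x' ∧ galAutE E τ yb = y' := by
        intro τ
        obtain ⟨x', y', h', hQ, hx'⟩ := exists_eq_some_of_add_nsmul_T hV hxyb hxb (n τ).val
        have hτb : τ • b₀ = (Affine.Point.some (galAutE E τ xb) (galAutE E τ yb) (nonsingular_galAutE τ hxyb) :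
            localPoints (cpCurve a b) E) :=
          smul_localPoints_some τ hxyb (nonsingular_galAutE τ hxyb)
        have e : τ • b₀ = (Affine.Point.some x' y' h' : localPoints (cpCurve a b) E) := (hσb τ).trans hQ
        rw [hτb] at e
        obtain ⟨h1, h2⟩ := Affine.Point.some.inj e
        exact ⟨x', y', h', hQ, hx', h1, h2⟩
      -- the Vélu coordinates have coefficients fixed by `Γ_E`
      have hXform : ∀ x : AlgebraicClosure E,
          hV.X x = (x ^ 3 - 12 * cE E a * cE E b * x - 12 * cE E b ^ 2) / x ^ 2 := fun x => X_eq' hV hθ x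
      have hYform : ∀ x y : AlgebraicClosure E,
          hV.Y x y = y * (x ^ 3 + 12 * cE E a * cE E b * x + 24 * cE E b ^ 2) / x ^ 3 :=
        fun x y => Y_eq' hV hθ x y
      have hfixX : ∀ τ : Field.absoluteGaloisGroup E,
          galAutE E τ (hV.X xb) = hV.X xb ∧ galAutE E τ (hV.Y xb yb) = hV.Y xb yb := by
        intro τ
        obtain ⟨x', y', h', hQ, hx', hτx, hτy⟩ := hmove τ
        have hφ : hV.pointFun (Affine.Point.some x' y' h') = hV.pointFun (Affine.Point.some xb yb hxyb) := by
          rw [← hQ, ← hV.pointHom_apply, map_add, map_nsmul, hV.pointHom_apply, hV.pointHom_apply,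
            hV.pointFun_T, smul_zero, add_zero]
        rw [hV.pointFun_some _ hx', hV.pointFun_some _ hxb] at hφ
        obtain ⟨hX', hY'⟩ := Affine.Point.some.inj hφ
        constructor
        · calc galAutE E τ (hV.X xb) = hV.X (galAutE E τ xb) := by
                rw [hXform xb, hXform (galAutE E τ xb)]
                simp only [map_div₀, map_sub, map_pow, map_mul, map_ofNat, galAutE_cE]
            _ = hV.X xb := by rw [hτx, hX']
        · calc galAutE E τ (hV.Y xb yb) = hV.Y (galAutE E τ xb) (galAutE E τ yb) := by
                rw [hYform xb yb, hYform (galAutE E τ xb) (galAutE E τ yb)]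
                simp only [map_div₀, map_add, map_pow, map_mul, map_ofNat, galAutE_cE]
            _ = hV.Y xb yb := by rw [hτx, hτy, hY']
      obtain ⟨X₀, hX₀⟩ := exists_algebraMap_eq_of_forall_galAut (K := E) fun τ => (hfixX τ).1
      obtain ⟨Y₀, hY₀⟩ := exists_algebraMap_eq_of_forall_galAut (K := E) fun τ => (hfixX τ).2
      -- the `E`-rational points `P± = ((X₀ − 4a²)/t², ±Y₀/t³)` of `Ê`
      have hYsq : Y₀ ^ 2 = (X₀ - 4 * aE ^ 2) ^ 3 + (3 * aE * (X₀ - 4 * aE ^ 2) + (4 * aE ^ 3 + 9 * bE)) ^ 2 := by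
        apply hEinj
        have e := Y_sq_eq hV hθ hxyb hxb
        rw [← hX₀, ← hY₀, hcEa, hcEb] at e
        simpa only [map_pow, map_add, map_sub, map_mul, map_ofNat] using e
      have hYsq' : (-Y₀) ^ 2 = (X₀ - 4 * aE ^ 2) ^ 3 + (3 * aE * (X₀ - 4 * aE ^ 2) + (4 * aE ^ 3 + 9 * bE)) ^ 2 := by
        rw [neg_sq, hYsq]
      set X₂ := (X₀ - 4 * aE ^ 2) / tE ^ 2 with hX₂
      have hEqP : W₂.toAffine.Equation X₂ (Y₀ / tE ^ 3) := equation_scaled htE0 hmE2 hsE2 hYsq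
      have hEqM : W₂.toAffine.Equation X₂ (-Y₀ / tE ^ 3) := equation_scaled htE0 hmE2 hsE2 hYsq'
      have hnsP := (Affine.equation_iff_nonsingular_of_Δ_ne_zero hΔ₂).mp hEqP
      have hnsM := (Affine.equation_iff_nonsingular_of_Δ_ne_zero hΔ₂).mp hEqM
      -- the descent functions at `P±`, in terms of `g∓(b₀)³`
      have hgm3 : gFun (-cE E a) (-cE E b) b₀ ^ 3 =
          hV.Y xb yb - 3 * cE E a * (hV.X xb - 4 * cE E a ^ 2) - (4 * cE E a ^ 3 + 9 * cE E b) :=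
        gFun_neg_pow_three hV hθ hxyb hxb
      have hgp3 : gFun (cE E a) (cE E b) b₀ ^ 3 =
          hV.Y xb yb + 3 * cE E a * (hV.X xb - 4 * cE E a ^ 2) + (4 * cE E a ^ 3 + 9 * cE E b) :=
        gFun_pow_three hV hθ hxyb hxb
      have hδP : algebraMap E (AlgebraicClosure E) (tE ^ 3 * (Y₀ / tE ^ 3 - mE * X₂ - sE)) =
          gFun (-cE E a) (-cE E b) b₀ ^ 3 := by
        rw [hgm3, ← hX₀, ← hY₀, hcEa, hcEb]
        have e : tE ^ 3 * (Y₀ / tE ^ 3 - mE * X₂ - sE) =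
            Y₀ - 3 * aE * (X₀ - 4 * aE ^ 2) - (4 * aE ^ 3 + 9 * bE) := by
          rw [hX₂, ← hsE2]
          have : mE = 3 * aE / tE := by field_simp; linear_combination hmE2
          rw [this]
          field_simp
        rw [e]; simp only [map_sub, map_add, map_mul, map_pow, map_ofNat]
      have hδM : algebraMap E (AlgebraicClosure E) (tE ^ 3 * (-Y₀ / tE ^ 3 - mE * X₂ - sE)) =
          -gFun (cE E a) (cE E b) b₀ ^ 3 := by
        rw [hgp3, ← hX₀, ← hY₀, hcEa, hcEb]
        have e : tE ^ 3 * (-Y₀ / tE ^ 3 - mE * X₂ - sE) =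
            -(Y₀ + 3 * aE * (X₀ - 4 * aE ^ 2) + (4 * aE ^ 3 + 9 * bE)) := by
          rw [hX₂, ← hsE2]
          have : mE = 3 * aE / tE := by field_simp; linear_combination hmE2
          rw [this]
          field_simp; ring
        rw [e]; simp only [map_neg, map_sub, map_add, map_mul, map_pow, map_ofNat]
      /- the `g`-function argument over `Ē`: for `(c, e) = (1, 1)` with `g = g₋` (moved by `ι(ω)²`) or
      `(c, e) = (2, 2)`… precisely: if `τ g = ι(ω)^{c n(τ)} g` with `c + e ≡ 0 (mod 3)`, then
      `g (ι∛u)^e` is `Γ_E`-fixed, with cube `g³ u^e` -/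
      have gArg : ∀ (g : AlgebraicClosure E) (c e : ℕ), c + e = 3 →
          (∀ τ : Field.absoluteGaloisGroup E, galAutE E τ g = iotaE (K := K) E (omega K) ^ (c * (n τ).val) * g) →
          ∃ w : E, algebraMap E (AlgebraicClosure E) w ^ 3 = g ^ 3 * algebraMap E (AlgebraicClosure E) uE ^ e := by
        intro g c e hce hσg
        set wt := g * iotaE (K := K) E (cubeRoot u) ^ e with hwt
        have hfix : ∀ τ : Field.absoluteGaloisGroup E, galAutE E τ wt = wt := by
          intro τ
          have h3 : c * (n τ).val + (n τ).val * e = 3 * (n τ).val := by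
            rw [mul_comm c, ← mul_add, hce, mul_comm]
          have hω : iotaE (K := K) E (omega K) ^ (c * (n τ).val) *
              iotaE (K := K) E (omega K) ^ ((n τ).val * e) = 1 := by
            rw [← pow_add, h3, pow_mul, hω3, one_pow]
          rw [hwt, map_mul, map_pow, hσg τ, hτα τ, mul_pow, ← pow_mul]
          calc iotaE (K := K) E (omega K) ^ (c * (n τ).val) * g *
                (iotaE (K := K) E (omega K) ^ ((n τ).val * e) * iotaE (K := K) E (cubeRoot u) ^ e)
              = (iotaE (K := K) E (omega K) ^ (c * (n τ).val) * iotaE (K := K) E (omega K) ^ ((n τ).val * e)) *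
                  (g * iotaE (K := K) E (cubeRoot u) ^ e) := by ring
            _ = g * iotaE (K := K) E (cubeRoot u) ^ e := by rw [hω, one_mul]
        obtain ⟨w, hw⟩ := exists_algebraMap_eq_of_forall_galAut (K := E) hfix
        refine ⟨w, ?_⟩
        rw [hw, hwt, mul_pow, ← pow_mul, mul_comm e 3, pow_mul, hα3]
      -- how `τ` moves `g±(b₀)`: through `τ b₀ = b₀ + n(τ) T_E`
      have hσgp : ∀ τ : Field.absoluteGaloisGroup E, galAutE E τ (gFun (cE E a) (cE E b) b₀) =
          iotaE (K := K) E (omega K) ^ (1 * (n τ).val) * gFun (cE E a) (cE E b) b₀ := by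
        intro τ
        obtain ⟨x', y', h', hQ, hx', hτx, hτy⟩ := hmove τ
        have h1 : galAutE E τ (gFun (cE E a) (cE E b) b₀) = gFun (cE E a) (cE E b) (Affine.Point.some x' y' h') := by
          rw [hbdef, gFun_some, gFun_some, map_div₀, map_add, map_add, map_mul, map_mul, galAutE_cE,
            galAutE_cE, map_ofNat, hτx, hτy]
        rw [h1, ← hQ, gFun_add_nsmul_T hV hθ _ (n τ).val, one_mul, ← hωθ, hbdef]
      have hσgm : ∀ τ : Field.absoluteGaloisGroup E, galAutE E τ (gFun (-cE E a) (-cE E b) b₀) =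
          iotaE (K := K) E (omega K) ^ (2 * (n τ).val) * gFun (-cE E a) (-cE E b) b₀ := by
        intro τ
        obtain ⟨x', y', h', hQ, hx', hτx, hτy⟩ := hmove τ
        have h1 : galAutE E τ (gFun (-cE E a) (-cE E b) b₀) =
            gFun (-cE E a) (-cE E b) (Affine.Point.some x' y' h') := by
          rw [hbdef, gFun_some, gFun_some, map_div₀, map_add, map_add, map_mul, map_mul, map_neg, map_neg,
            galAutE_cE, galAutE_cE, map_ofNat, hτx, hτy]
        rw [h1, ← hQ, gFun_neg_add_nsmul_T hV hθ _ (n τ).val, hω2, ← pow_mul, hbdef]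
      by_cases hgm : gFun (-cE E a) (-cE E b) b₀ = 0
      · /- `g₋(b₀) = 0`: then `g₊(b₀) ≠ 0`; use `P⁻ = (X₂, −Y₀/t³)`, `e = 1`:
        `t³ α̂(P⁻) = −g₊³`, `w³ = g₊³ u²` … we get `α̂(P⁻) · u · (…)³`; cleaner: `α̂(P⁻)¹ = u w³` -/
        have hgp0 : gFun (cE E a) (cE E b) b₀ ≠ 0 := by
          rcases gFun_ne_zero_or hV hθ hxyb hxb with h | h
          · exact h
          · exact absurd hgm h
        obtain ⟨w, hw⟩ := gArg _ 1 2 rfl hσgp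
        -- `α̂(P⁻) ≠ 0`: it is `−g₊³/t³`
        have hδM0 : -Y₀ / tE ^ 3 - mE * X₂ - sE ≠ 0 := by
          intro h0
          have : algebraMap E (AlgebraicClosure E) (tE ^ 3 * (-Y₀ / tE ^ 3 - mE * X₂ - sE)) = 0 := by
            rw [h0, mul_zero, map_zero]
          rw [hδM, neg_eq_zero] at this
          exact hgp0 (pow_eq_zero_iff three_ne_zero |>.mp this)
        have hwE : w ^ 3 = -(tE ^ 3 * (-Y₀ / tE ^ 3 - mE * X₂ - sE)) * uE ^ 2 := by
          apply hEinj
          rw [map_pow, hw, map_mul, map_neg, hδM, neg_neg, map_pow]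
        have hw0 : w ≠ 0 := by
          rintro rfl
          have : -(tE ^ 3 * (-Y₀ / tE ^ 3 - mE * X₂ - sE)) * uE ^ 2 = 0 := by rw [← hwE]; ring
          exact mul_ne_zero (neg_ne_zero.mpr (mul_ne_zero (pow_ne_zero 3 htE0) hδM0)) (pow_ne_zero 2 huE0) this
        refine ⟨Affine.Point.some _ _ hnsM, -w / (tE * uE), 1, div_ne_zero (neg_ne_zero.mpr hw0)
          (mul_ne_zero htE0 huE0), ?_⟩
        rw [descent_some_of_ne _ _ _ hδM0, pow_one]
        have e3 : (-w / (tE * uE)) ^ 3 = -(w ^ 3) / (tE ^ 3 * uE ^ 3) := by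
          rw [div_pow, neg_pow, mul_pow]; ring
        rw [e3, hwE]
        field_simp
      · /- `g₋(b₀) ≠ 0`: use `P⁺ = (X₂, Y₀/t³)`, `e = 2`: `t³ α̂(P⁺) = g₋³`, `w³ = g₋³ u`, so
        `α̂(P⁺)² = u · (w²/(u t²))³` -/
        obtain ⟨w, hw⟩ := gArg _ 2 1 rfl hσgm
        have hδP0 : Y₀ / tE ^ 3 - mE * X₂ - sE ≠ 0 := by
          intro h0
          have : algebraMap E (AlgebraicClosure E) (tE ^ 3 * (Y₀ / tE ^ 3 - mE * X₂ - sE)) = 0 := by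
            rw [h0, mul_zero, map_zero]
          rw [hδP] at this
          exact hgm (pow_eq_zero_iff three_ne_zero |>.mp this)
        have hwE : w ^ 3 = (tE ^ 3 * (Y₀ / tE ^ 3 - mE * X₂ - sE)) * uE := by
          apply hEinj
          rw [map_pow, hw, map_mul, hδP, pow_one]
        have hw0 : w ≠ 0 := by
          rintro rfl
          have : (tE ^ 3 * (Y₀ / tE ^ 3 - mE * X₂ - sE)) * uE = 0 := by rw [← hwE]; ring
          exact mul_ne_zero (mul_ne_zero (pow_ne_zero 3 htE0) hδP0) huE0 this
        refine ⟨Affine.Point.some _ _ hnsP, w ^ 2 / (uE * tE ^ 2), 2, div_ne_zero (pow_ne_zero 2 hw0)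
          (mul_ne_zero huE0 (pow_ne_zero 2 htE0)), ?_⟩
        rw [descent_some_of_ne _ _ _ hδP0, div_pow, ← pow_mul, show 2 * 3 = 3 * 2 by rfl, pow_mul, hwE]
        field_simp

/-- **The local conditions are necessary for `Ш`** (over a number field `K`): if `[C_u] ∈ Ш(E/K)`
then at every finite place `v`, `α̂(P)^e = u w³` for some `P ∈ Ê(K_v)`, `w ∈ K_v*`.
[cite: SilvermanAEC2009, Thm. X.4.2(a) and Prop. X.4.9] -/
theorem exists_descent_pow_eq_adicCompletion_of_torsorClass_mem_sha [NumberField K] (ht : t ≠ 0)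
    (hm₂ : t * m₂ = 3 * a) (hs₂ : t ^ 3 * s₂ = 4 * a ^ 3 + 9 * b) {u : K} (hu : u ≠ 0)
    (hsha : (kernelDatum hb hd).torsorClass hu ∈ (cpCurve a b).sha)
    (v : IsDedekindDomain.HeightOneSpectrum (NumberField.RingOfIntegers K)) :
    ∃ (P : (threeTorsionModel (algebraMap K (v.adicCompletion K) m₂)
        (algebraMap K (v.adicCompletion K) s₂)).toAffine.Point) (w : v.adicCompletion K) (e : ℕ),
      w ≠ 0 ∧ descent (threeTorsionModel (algebraMap K (v.adicCompletion K) m₂)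
        (algebraMap K (v.adicCompletion K) s₂)) (algebraMap K (v.adicCompletion K) m₂)
          (algebraMap K (v.adicCompletion K) s₂) P ^ e = algebraMap K (v.adicCompletion K) u * w ^ 3 := by
  refine exists_descent_pow_eq_of_torsorClass_mem_localRestrictionKer hb hd ht hm₂ hs₂ hu ?_
  rw [WeierstrassCurve.mem_sha_iff] at hsha
  exact hsha.1 v

/-- The same at the infinite places. [cite: SilvermanAEC2009, Thm. X.4.2(a) and Prop. X.4.9] -/
theorem exists_descent_pow_eq_infinitePlace_of_torsorClass_mem_sha [NumberField K] (ht : t ≠ 0)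
    (hm₂ : t * m₂ = 3 * a) (hs₂ : t ^ 3 * s₂ = 4 * a ^ 3 + 9 * b) {u : K} (hu : u ≠ 0)
    (hsha : (kernelDatum hb hd).torsorClass hu ∈ (cpCurve a b).sha) (v : NumberField.InfinitePlace K) :
    ∃ (P : (threeTorsionModel (algebraMap K v.Completion m₂) (algebraMap K v.Completion s₂)).toAffine.Point)
      (w : v.Completion) (e : ℕ),
      w ≠ 0 ∧ descent (threeTorsionModel (algebraMap K v.Completion m₂) (algebraMap K v.Completion s₂))
        (algebraMap K v.Completion m₂) (algebraMap K v.Completion s₂) P ^ e =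
          algebraMap K v.Completion u * w ^ 3 := by
  refine exists_descent_pow_eq_of_torsorClass_mem_localRestrictionKer hb hd ht hm₂ hs₂ hu ?_
  rw [WeierstrassCurve.mem_sha_iff] at hsha
  exact hsha.2 v

end Local

end CPMuDescent

end Literature.NumberTheory.EllipticCurves

end
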